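/-
Copyright (c) 2026 the pub-hodgecm-mathlib formalisation cell (harness21).  Prover seat hodgecm-mathlib-F0P3-p03 (g15): road «S3-ram» (LEAD F0P3a-plan (g13); owner
F0P3a-p06 (g15)); junction J-PACK v2-iso, `row_S45_hyperbolic` HYP-PLAN v1 (F0P3a-p04 (g19)) node (V3) «REGION BRANCHING», lattice half; 2026-09-02.
-/
import Literature.NumberTheory.Automorphic.UnitaryLatticeTreeIsocelesRegionLinesRamified   -- ★ p848140 (this seat): criterion, DIST, κ-keyed LINE TEST
import Literature.NumberTheory.Automorphic.UnitaryLatticeTreeSliceCountKeyedRamified      -- ★ p847638 (F0P2-p06 (g13)): κ-keyed slice count `ncard_fixedGrandchildren_sep_eq_mul_ncard_keyed`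
import HarnessLib

/-!
# The lattice graph of a hermitian space — THE ISOCELES REGION: BRANCHING (region grandchildren = `q` · outward region directions; the inward direction is a region direction)
# (Serre, *Trees* I.2.3, II.1.1; Kottwitz 1986 §3; Bruhat–Tits 1972 §10)

Topic `NumberTheory/Automorphic`; namespace `Literature.NumberTheory.Automorphic.UnitaryLatticeTree`.  THEOREMS ONLY (no definition, no instance, no notation, no named fact,
no `sorry`); kernel lane `--supports stmt-HodgeConjecture-24833`.  Cell `pub/hodgecm-mathlib` (D-0151), crux H413; road «S3-ram» (Literature seeding, count-neutral); junction
(J★), ISOCELES wave: `row_S45_hyperbolic` (S45 v4, hand F0P3a-p02 (g17) → F0P3a-p04 (g19) HYP-PLAN v1 94da2402), node **(V3) REGION BRANCHING**, lattice half (the residual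
line count «2 isotropic lines ⊥ w̄» is LH4-p02 (g0)'s; the layer sum is ★ `ncard_region_eq_of_branching` (F0P3a-p02 (g17))).

THE REGION DIRECTIONS of a region vertex `v = u·r₀` (fixed, self-dual, `LEV[v](ϖ^{d₀})`) are the children `(uκ)·N₁` (`κ ∈ K₀`) whose line passes the LINE TEST
`RegDir_u κ : |⟨(uκ)e₀, A e_{i₀}⟩| < 1 ∧ |⟨(uκ)e₀, ϖ^{s'}·A e_k⟩| < 1` (★ `lev_iff_v_pairing_lt_one_of_adj_keyed`: ALL `q` far vertices through such a child are in the region,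
none through the others).  §11 **`ncard_regionGrandchildren_eq_mul_ncard_regDir`**: `#{w ∈ GC v | w ∈ R} = q · #{outward region directions of v}` (★ κ-keyed slice count with
`P := (· ∈ R)`, `Pκ := RegDir_u`).  §12 **`ncard_outward_regDir_add_one_eq_ncard_regDir`**: for `v ≠ r₀` the INWARD child is a region direction (the grandparent is a region far
vertex through it: ★ `exists_parent_grandparent_lev_of_neg` + the LINE TEST), so `#{outward region directions} + 1 = #{region directions}`; at the root every child is outward
(§12 `ncard_regionGrandchildren_root_eq_mul_ncard_regDir`).  With LH4-p02's residual count `#{region directions} = 2` at every region vertex of distance `< 2s'` this is the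
branching `2q ∕ q` consumed by ★ `ncard_region_eq_of_branching` (`b₀ = 2q`, `b = q`, `hmax` = ★ DIST `dist_root_le_of_lev_of_neg`): `#R = 1 + 2q·Σ_{i<s'} qⁱ`, `#END = 2q^{s'}`.

* §11 `scaleLattice_pow_le_scaleLattice_pow_of_le`, **`ncard_regionGrandchildren_eq_mul_ncard_regDir`**.
* §12 **`ncard_outward_regDir_add_one_eq_ncard_regDir`**, **`ncard_regionGrandchildren_root_eq_mul_ncard_regDir`**.

HONEST LABEL: HC_CM is proved only modulo the 2 remaining named inputs (hLiu418 24832, h413 24833) until rung 0 closes; nothing printed is asserted here (rooted-tree bookkeeping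
over the ★ slice counts); «S3-ram» has no books consequence.

## References
* [Serre1980Trees] J.-P. Serre, *Trees* (1980), I.2.3 (rooted trees: parent, layers), II.1.1 (lattices, neighbours).
* [Kottwitz1986] R. E. Kottwitz, *Base change for unit elements of Hecke algebras*, Compositio Math. 60 (1986), §3 (counting fixed lattices shell by shell).
* [BruhatTits1972] F. Bruhat, J. Tits, *Groupes réductifs sur un corps local I*, Publ. Math. IHÉS 41 (1972), §10.
-/

set_option autoImplicit false

noncomputable section

open scoped Valued WithZero Matrix MatrixGroups

namespace Literature.NumberTheory.Automorphic.UnitaryLatticeTree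

open Literature.NumberTheory.Automorphic Literature.NumberTheory.Automorphic.HermitianLattice
open Literature.Combinatorics.SimpleGraph.TreeLayers

variable {K : Type*} [Field K] [Valued K ℤᵐ⁰] {σ : K →+* K} {ϖ : K}

/-! ## §11 Region grandchildren = `q` · outward region directions -/

/-- `ϖ^{e'}·M ≤ ϖ^{e}·M` for `e ≤ e'` (`|ϖ| ≤ 1`). [cite: Serre1980Trees, II.1.1] -/
theorem scaleLattice_pow_le_scaleLattice_pow_of_le {N : ℕ} (hϖ1 : Valued.v ϖ ≤ 1) (M : Submodule 𝒪[K] (Fin N → K)) {e e' : ℕ} (h : e ≤ e') :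
    scaleLattice (ϖ ^ e') M ≤ scaleLattice (ϖ ^ e) M := by
  obtain ⟨f, rfl⟩ := Nat.exists_eq_add_of_le h
  rw [pow_add, ← scaleLattice_scaleLattice]
  exact scaleLattice_mono _ (scaleLattice_le_self_of_v_le_one (by rw [map_pow]; exact pow_le_one' hϖ1 _) M)

/-- **REGION GRANDCHILDREN = `q` · OUTWARD REGION DIRECTIONS.**  `γ = A·diag(s)·A⁻¹ ∈ U(J₀)` with the isoceles eigen-data (`d₀ ≥ 2`, exact close-pair gap), `v = u·r₀` a
fixed self-dual vertex with `LEV[v](ϖ^{d₀})`; the region `R = {γw = w ∧ SD w ∧ LEV[w](ϖ^{d₀})}`.  Then the region grandchildren of `v` away from the root number `q` times the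
outward children `(uκ)·N₁` with `RegDir_u κ` (★ κ-keyed slice count + ★ κ-keyed LINE TEST). [cite: Serre1980Trees, I.2.3] [cite: Kottwitz1986, §3] [cite: BruhatTits1972, §10] -/
theorem ncard_regionGrandchildren_eq_mul_ncard_regDir (hσ : ∀ x, σ (σ x) = x) (hvσ : ∀ a, Valued.v (σ a) = Valued.v a) (hσϖ : σ ϖ = -ϖ)
    (hϖ : Valued.v ϖ = WithZero.exp (-1 : ℤ)) (hres : ∀ x : K, Valued.v x ≤ 1 → Valued.v (σ x - x) < 1) (h2 : Valued.v (2 : K) = 1) [Finite 𝓀[K]]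
    (hT : (latticeGraph σ ϖ ((StdForm.antidiagonal 3).over K)).IsTree)
    {γ : unitaryGroupOfForm σ ((StdForm.antidiagonal 3).over K)}
    (A : GL (Fin 3) K) {d : Fin 3 → K} (hd : ∀ i, Valued.v (d i) = 1)
    (hdA : Matrix.diagonal d = (-(Matrix.diagonal d).det) • formCongr σ A ((StdForm.antidiagonal 3).over K))
    (s : Fin 3 → K) (hγA : ((γ : GL (Fin 3) K) : Matrix (Fin 3) (Fin 3) K) = (A : Matrix (Fin 3) (Fin 3) K) * Matrix.diagonal s * ((A⁻¹ : GL (Fin 3) K) : Matrix (Fin 3) (Fin 3) K))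
    (i₀ : Fin 3) {d₀ : ℕ} (hd2 : 2 ≤ d₀) (he : ∀ i, Valued.v (s i - 1) ≤ Valued.v ϖ ^ d₀) (hiso : ∀ m, m ≠ i₀ → Valued.v (s i₀ - s m) = Valued.v ϖ ^ d₀) {s' : ℕ}
    (hgap : ∀ j k, j ≠ i₀ → k ≠ i₀ → j ≠ k → Valued.v (s j - s k) = Valued.v ϖ ^ (d₀ + 2 * s')) {k : Fin 3} (hk : k ≠ i₀)
    (u : unitaryGroupOfForm σ ((StdForm.antidiagonal 3).over K)) {v : {M : Submodule 𝒪[K] (Fin 3 → K) // IsVertex σ ϖ ((StdForm.antidiagonal 3).over K) M}}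
    (hvu : v = latticeGraphIso σ ϖ ((StdForm.antidiagonal 3).over K) u ⟨stdLattice K 3, 0, isSelfDualLattice_stdLattice_three_of_v hϖ⟩)
    (hfix : latticeGraphIso σ ϖ ((StdForm.antidiagonal 3).over K) γ v = v)
    (hvR : v.1.map ((Matrix.toLin' (((γ : GL (Fin 3) K) : Matrix (Fin 3) (Fin 3) K) - 1)).restrictScalars 𝒪[K]) ≤ scaleLattice (ϖ ^ d₀) v.1) :
    {w | w ∈ {w | ∃ c, ((latticeGraph σ ϖ ((StdForm.antidiagonal 3).over K)).Adj v c ∧ (latticeGraph σ ϖ ((StdForm.antidiagonal 3).over K)).dist ⟨stdLattice K 3, 0, isSelfDualLattice_stdLattice_three_of_v hϖ⟩ c = (latticeGraph σ ϖ ((StdForm.antidiagonal 3).over K)).dist ⟨stdLattice K 3, 0, isSelfDualLattice_stdLattice_three_of_v hϖ⟩ v + 1 ∧ latticeGraphIso σ ϖ ((StdForm.antidiagonal 3).over K) γ c = c) ∧ ((latticeGraph σ ϖ ((StdForm.antidiagonal 3).over K)).Adj c w ∧ (latticeGraph σ ϖ ((StdForm.antidiagonal 3).over K)).dist ⟨stdLattice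 K 3, 0, isSelfDualLattice_stdLattice_three_of_v hϖ⟩ w = (latticeGraph σ ϖ ((StdForm.antidiagonal 3).over K)).dist ⟨stdLattice K 3, 0, isSelfDualLattice_stdLattice_three_of_v hϖ⟩ c + 1 ∧ latticeGraphIso σ ϖ ((StdForm.antidiagonal 3).over K) γ w = w)} ∧
        (latticeGraphIso σ ϖ ((StdForm.antidiagonal 3).over K) γ w = w ∧ IsSelfDualLattice σ ϖ ((StdForm.antidiagonal 3).over K) w.1 ∧
          w.1.map ((Matrix.toLin' (((γ : GL (Fin 3) K) : Matrix (Fin 3) (Fin 3) K) - 1)).restrictScalars 𝒪[K]) ≤ scaleLattice (ϖ ^ d₀) w.1)}.ncard =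
      Nat.card 𝓀[K] * {c : {M : Submodule 𝒪[K] (Fin 3 → K) // IsVertex σ ϖ ((StdForm.antidiagonal 3).over K) M} | (latticeGraph σ ϖ ((StdForm.antidiagonal 3).over K)).Adj v c ∧ (latticeGraph σ ϖ ((StdForm.antidiagonal 3).over K)).dist ⟨stdLattice K 3, 0, isSelfDualLattice_stdLattice_three_of_v hϖ⟩ c = (latticeGraph σ ϖ ((StdForm.antidiagonal 3).over K)).dist ⟨stdLattice K 3, 0, isSelfDualLattice_stdLattice_three_of_v hϖ⟩ v + 1 ∧ ∃ κ : unitaryGroupOfForm σ ((StdForm.antidiagonal 3).over K), κ ∈ unitaryInt σ ((StdForm.antidiagonal 3).over K) ∧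
        c = latticeGraphIso σ ϖ ((StdForm.antidiagonal 3).over K) (u * κ) ⟨latt (Matrix.diagonal ![(1 : K), 1, ϖ]), 2, isVertexLattice_two_N₁_of_neg hσϖ hϖ⟩ ∧
        (Valued.v (pairing σ ((StdForm.antidiagonal 3).over K) ((((u * κ : unitaryGroupOfForm σ ((StdForm.antidiagonal 3).over K)) : GL (Fin 3) K) : Matrix (Fin 3) (Fin 3) K) *ᵥ Pi.single 0 1)
            ((A : Matrix (Fin 3) (Fin 3) K) *ᵥ Pi.single i₀ 1)) < 1 ∧
          Valued.v (pairing σ ((StdForm.antidiagonal 3).over K) ((((u * κ : unitaryGroupOfForm σ ((StdForm.antidiagonal 3).over K)) : GL (Fin 3) K) : Matrix (Fin 3) (Fin 3) K) *ᵥ Pi.single 0 1)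
            (ϖ ^ s' • ((A : Matrix (Fin 3) (Fin 3) K) *ᵥ Pi.single k 1))) < 1)}.ncard := by
  have hϖ1 : Valued.v ϖ ≤ 1 := by rw [hϖ, ← WithZero.exp_zero]; exact WithZero.exp_le_exp.2 (by norm_num)
  subst hvu
  have hlev2 := hvR.trans (scaleLattice_pow_le_scaleLattice_pow_of_le hϖ1 _ hd2)
  refine ncard_fixedGrandchildren_sep_eq_mul_ncard_keyed hσ hvσ hσϖ hϖ hres h2 hT u hfix hlev2 _ _ fun κ hκ w hw hγw hwv hcw => ?_
  have hLT := lev_iff_v_pairing_lt_one_of_adj_keyed hσ hvσ hσϖ hϖ A hd hdA s hγA i₀ he hiso hgap hk u rfl hvR κ hκ hw hwv hcw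
  constructor
  · rintro ⟨-, -, hwR⟩; exact hLT.1 hwR
  · intro hdir; exact ⟨hγw, hw, hLT.2 hdir⟩

/-! ## §12 The inward child of a region vertex is a region direction; the root -/

/-- **OUTWARD REGION DIRECTIONS + 1 = ALL REGION DIRECTIONS** at a region vertex `v = u·r₀ ≠ r₀` (tame-ramified place; `γ ∈ K₀` torus element with the isoceles
eigen-data): the inward child `c_in` (`dist(r₀, c_in) + 1 = dist(r₀, v)`) is `(uκ₀)·N₁` with `RegDir_u κ₀` — the grandparent is a self-dual far vertex through it carrying
`LEV(ϖ^{d₀})` (★ `exists_parent_grandparent_lev_of_neg`), so the LINE TEST fires — and every other child is outward. [cite: Serre1980Trees, I.2.3] [cite: Kottwitz1986, §3] -/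
theorem ncard_outward_regDir_add_one_eq_ncard_regDir (hσ : ∀ x, σ (σ x) = x) (hvσ : ∀ a, Valued.v (σ a) = Valued.v a) (hσϖ : σ ϖ = -ϖ)
    (hϖ : Valued.v ϖ = WithZero.exp (-1 : ℤ)) (hres : ∀ x : K, Valued.v x ≤ 1 → Valued.v (σ x - x) < 1) (h2 : Valued.v (2 : K) = 1)
    (hnorm : ∀ u : K, σ u = u → Valued.v (u - 1) < 1 → ∃ z : K, z * σ z = u ∧ Valued.v (z - 1) ≤ Valued.v (u - 1)) [Finite 𝓀[K]]
    [ValuativeRel K] [(Valued.v : Valuation K ℤᵐ⁰).Compatible]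
    (hT : (latticeGraph σ ϖ ((StdForm.antidiagonal 3).over K)).IsTree)
    {γ : unitaryGroupOfForm σ ((StdForm.antidiagonal 3).over K)} (hγ0 : γ ∈ unitaryInt σ ((StdForm.antidiagonal 3).over K))
    (A : GL (Fin 3) K) (hA : IsIntMatrix (A : Matrix (Fin 3) (Fin 3) K)) (hA' : IsIntMatrix ((A⁻¹ : GL (Fin 3) K) : Matrix (Fin 3) (Fin 3) K))
    {d : Fin 3 → K} (hd : ∀ i, Valued.v (d i) = 1) (hdA : Matrix.diagonal d = (-(Matrix.diagonal d).det) • formCongr σ A ((StdForm.antidiagonal 3).over K))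
    (s : Fin 3 → K) (hγA : ((γ : GL (Fin 3) K) : Matrix (Fin 3) (Fin 3) K) = (A : Matrix (Fin 3) (Fin 3) K) * Matrix.diagonal s * ((A⁻¹ : GL (Fin 3) K) : Matrix (Fin 3) (Fin 3) K))
    (i₀ : Fin 3) {d₀ : ℕ} (he : ∀ i, Valued.v (s i - 1) ≤ Valued.v ϖ ^ d₀) (hiso : ∀ m, m ≠ i₀ → Valued.v (s i₀ - s m) = Valued.v ϖ ^ d₀) {s' : ℕ}
    (hgap : ∀ j k, j ≠ i₀ → k ≠ i₀ → j ≠ k → Valued.v (s j - s k) = Valued.v ϖ ^ (d₀ + 2 * s')) {k : Fin 3} (hk : k ≠ i₀)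
    (u : unitaryGroupOfForm σ ((StdForm.antidiagonal 3).over K)) {v : {M : Submodule 𝒪[K] (Fin 3 → K) // IsVertex σ ϖ ((StdForm.antidiagonal 3).over K) M}}
    (hvu : v = latticeGraphIso σ ϖ ((StdForm.antidiagonal 3).over K) u ⟨stdLattice K 3, 0, isSelfDualLattice_stdLattice_three_of_v hϖ⟩)
    (hvr : v ≠ ⟨stdLattice K 3, 0, isSelfDualLattice_stdLattice_three_of_v hϖ⟩)
    (hfix : latticeGraphIso σ ϖ ((StdForm.antidiagonal 3).over K) γ v = v)
    (hvR : v.1.map ((Matrix.toLin' (((γ : GL (Fin 3) K) : Matrix (Fin 3) (Fin 3) K) - 1)).restrictScalars 𝒪[K]) ≤ scaleLattice (ϖ ^ d₀) v.1) :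
    {c : {M : Submodule 𝒪[K] (Fin 3 → K) // IsVertex σ ϖ ((StdForm.antidiagonal 3).over K) M} | (latticeGraph σ ϖ ((StdForm.antidiagonal 3).over K)).Adj v c ∧ (latticeGraph σ ϖ ((StdForm.antidiagonal 3).over K)).dist ⟨stdLattice K 3, 0, isSelfDualLattice_stdLattice_three_of_v hϖ⟩ c = (latticeGraph σ ϖ ((StdForm.antidiagonal 3).over K)).dist ⟨stdLattice K 3, 0, isSelfDualLattice_stdLattice_three_of_v hϖ⟩ v + 1 ∧ ∃ κ : unitaryGroupOfForm σ ((StdForm.antidiagonal 3).over K), κ ∈ unitaryInt σ ((StdForm.antidiagonal 3).over K) ∧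
        c = latticeGraphIso σ ϖ ((StdForm.antidiagonal 3).over K) (u * κ) ⟨latt (Matrix.diagonal ![(1 : K), 1, ϖ]), 2, isVertexLattice_two_N₁_of_neg hσϖ hϖ⟩ ∧
        (Valued.v (pairing σ ((StdForm.antidiagonal 3).over K) ((((u * κ : unitaryGroupOfForm σ ((StdForm.antidiagonal 3).over K)) : GL (Fin 3) K) : Matrix (Fin 3) (Fin 3) K) *ᵥ Pi.single 0 1)
            ((A : Matrix (Fin 3) (Fin 3) K) *ᵥ Pi.single i₀ 1)) < 1 ∧
          Valued.v (pairing σ ((StdForm.antidiagonal 3).over K) ((((u * κ : unitaryGroupOfForm σ ((StdForm.antidiagonal 3).over K)) : GL (Fin 3) K) : Matrix (Fin 3) (Fin 3) K) *ᵥ Pi.single 0 1)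
            (ϖ ^ s' • ((A : Matrix (Fin 3) (Fin 3) K) *ᵥ Pi.single k 1))) < 1)}.ncard + 1 =
      {c : {M : Submodule 𝒪[K] (Fin 3 → K) // IsVertex σ ϖ ((StdForm.antidiagonal 3).over K) M} | (latticeGraph σ ϖ ((StdForm.antidiagonal 3).over K)).Adj v c ∧ ∃ κ : unitaryGroupOfForm σ ((StdForm.antidiagonal 3).over K), κ ∈ unitaryInt σ ((StdForm.antidiagonal 3).over K) ∧
        c = latticeGraphIso σ ϖ ((StdForm.antidiagonal 3).over K) (u * κ) ⟨latt (Matrix.diagonal ![(1 : K), 1, ϖ]), 2, isVertexLattice_two_N₁_of_neg hσϖ hϖ⟩ ∧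
        (Valued.v (pairing σ ((StdForm.antidiagonal 3).over K) ((((u * κ : unitaryGroupOfForm σ ((StdForm.antidiagonal 3).over K)) : GL (Fin 3) K) : Matrix (Fin 3) (Fin 3) K) *ᵥ Pi.single 0 1)
            ((A : Matrix (Fin 3) (Fin 3) K) *ᵥ Pi.single i₀ 1)) < 1 ∧
          Valued.v (pairing σ ((StdForm.antidiagonal 3).over K) ((((u * κ : unitaryGroupOfForm σ ((StdForm.antidiagonal 3).over K)) : GL (Fin 3) K) : Matrix (Fin 3) (Fin 3) K) *ᵥ Pi.single 0 1)
            (ϖ ^ s' • ((A : Matrix (Fin 3) (Fin 3) K) *ᵥ Pi.single k 1))) < 1)}.ncard := by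
  classical
  set G := latticeGraph σ ϖ ((StdForm.antidiagonal 3).over K) with hG
  set r : {M : Submodule 𝒪[K] (Fin 3 → K) // IsVertex σ ϖ ((StdForm.antidiagonal 3).over K) M} :=
    ⟨stdLattice K 3, 0, isSelfDualLattice_stdLattice_three_of_v hϖ⟩ with hr
  -- abbreviation for the region-direction predicate
  set RD : unitaryGroupOfForm σ ((StdForm.antidiagonal 3).over K) → Prop := fun κ =>
    Valued.v (pairing σ ((StdForm.antidiagonal 3).over K) ((((u * κ : unitaryGroupOfForm σ ((StdForm.antidiagonal 3).over K)) : GL (Fin 3) K) : Matrix (Fin 3) (Fin 3) K) *ᵥ Pi.single 0 1)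
        ((A : Matrix (Fin 3) (Fin 3) K) *ᵥ Pi.single i₀ 1)) < 1 ∧
      Valued.v (pairing σ ((StdForm.antidiagonal 3).over K) ((((u * κ : unitaryGroupOfForm σ ((StdForm.antidiagonal 3).over K)) : GL (Fin 3) K) : Matrix (Fin 3) (Fin 3) K) *ᵥ Pi.single 0 1)
        (ϖ ^ s' • ((A : Matrix (Fin 3) (Fin 3) K) *ᵥ Pi.single k 1))) < 1 with hRD
  obtain ⟨p, hpar, hchild, -, -⟩ := exists_rooted_parent hT r
  have hv : IsSelfDualLattice σ ϖ ((StdForm.antidiagonal 3).over K) v.1 := by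
    rw [hvu]; exact isVertexLattice_mapGL σ ϖ ((StdForm.antidiagonal 3).over K) (u : GL (Fin 3) K) u.2 (isSelfDualLattice_stdLattice_three_of_v hϖ)
  -- the inward child and the grandparent carrying the token
  obtain ⟨p', g, hvp', hdp', hp'g, hgv, hgR⟩ :=
    exists_parent_grandparent_lev_of_neg hσ hvσ hσϖ hϖ hres h2 hnorm hT hγ0 A hA hA' s hγA he hv hvr hfix hvR
  have hdp : G.dist r p' + 1 = G.dist r v := hdp'
  have hp'eq : p' = p v := by
    by_contra hne
    have h := (hchild v p' hvr hvp' hne).1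
    omega
  obtain ⟨κ₀, hκ₀, hpκ⟩ := (mem_neighborSet_latticeGraphIso_root_iff hσ hvσ hσϖ hϖ h2 u p').1 (by rw [SimpleGraph.mem_neighborSet, ← hvu]; exact hvp')
  have hcw : G.Adj (latticeGraphIso σ ϖ ((StdForm.antidiagonal 3).over K) (u * κ₀) ⟨latt (Matrix.diagonal ![(1 : K), 1, ϖ]), 2, isVertexLattice_two_N₁_of_neg hσϖ hϖ⟩) g := by
    rw [← hpκ]; exact hp'g
  have hgSD : IsSelfDualLattice σ ϖ ((StdForm.antidiagonal 3).over K) g.1 := isSelfDualLattice_of_adj_latticeGraphIso_N₁ hvσ hσϖ hϖ (u * κ₀) hcw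
  have hRD₀ : RD κ₀ := (lev_iff_v_pairing_lt_one_of_adj_keyed hσ hvσ hσϖ hϖ A hd hdA s hγA i₀ he hiso hgap hk u hvu hvR κ₀ hκ₀ hgSD hgv hcw).1 hgR
  -- the region directions = the inward child plus the outward region directions
  have hfinv : (G.neighborSet v).Finite := by
    refine Set.finite_of_ncard_ne_zero ?_
    rw [hvu, ncard_neighborSet_latticeGraphIso, ncard_neighborSet_root_of_ramified hσ hvσ hϖ hres h2 (isVertexLattice_two_N₁_of_neg hσϖ hϖ)]
    exact Nat.succ_ne_zero _
  have hset : {c | G.Adj v c ∧ ∃ κ : unitaryGroupOfForm σ ((StdForm.antidiagonal 3).over K), κ ∈ unitaryInt σ ((StdForm.antidiagonal 3).over K) ∧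
        c = latticeGraphIso σ ϖ ((StdForm.antidiagonal 3).over K) (u * κ) ⟨latt (Matrix.diagonal ![(1 : K), 1, ϖ]), 2, isVertexLattice_two_N₁_of_neg hσϖ hϖ⟩ ∧ RD κ} =
      insert p' {c | G.Adj v c ∧ G.dist r c = G.dist r v + 1 ∧ ∃ κ : unitaryGroupOfForm σ ((StdForm.antidiagonal 3).over K), κ ∈ unitaryInt σ ((StdForm.antidiagonal 3).over K) ∧
        c = latticeGraphIso σ ϖ ((StdForm.antidiagonal 3).over K) (u * κ) ⟨latt (Matrix.diagonal ![(1 : K), 1, ϖ]), 2, isVertexLattice_two_N₁_of_neg hσϖ hϖ⟩ ∧ RD κ} := by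
    ext c
    simp only [Set.mem_setOf_eq, Set.mem_insert_iff]
    constructor
    · rintro ⟨hadj, κ, hκ, hc, hdir⟩
      by_cases hcp : c = p'
      · exact Or.inl hcp
      · exact Or.inr ⟨hadj, (hchild v c hvr hadj (by rw [← hp'eq]; exact hcp)).1, κ, hκ, hc, hdir⟩
    · rintro (hcp | ⟨hadj, -, hrest⟩)
      · rw [hcp]; exact ⟨hvp', κ₀, hκ₀, hpκ, hRD₀⟩
      · exact ⟨hadj, hrest⟩
  have hnotmem : p' ∉ {c | G.Adj v c ∧ G.dist r c = G.dist r v + 1 ∧ ∃ κ : unitaryGroupOfForm σ ((StdForm.antidiagonal 3).over K), κ ∈ unitaryInt σ ((StdForm.antidiagonal 3).over K) ∧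
        c = latticeGraphIso σ ϖ ((StdForm.antidiagonal 3).over K) (u * κ) ⟨latt (Matrix.diagonal ![(1 : K), 1, ϖ]), 2, isVertexLattice_two_N₁_of_neg hσϖ hϖ⟩ ∧ RD κ} := by
    rintro ⟨-, hdc, -⟩
    omega
  have hfinC : {c | G.Adj v c ∧ G.dist r c = G.dist r v + 1 ∧ ∃ κ : unitaryGroupOfForm σ ((StdForm.antidiagonal 3).over K), κ ∈ unitaryInt σ ((StdForm.antidiagonal 3).over K) ∧
        c = latticeGraphIso σ ϖ ((StdForm.antidiagonal 3).over K) (u * κ) ⟨latt (Matrix.diagonal ![(1 : K), 1, ϖ]), 2, isVertexLattice_two_N₁_of_neg hσϖ hϖ⟩ ∧ RD κ}.Finite :=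
    hfinv.subset (fun c hc => (SimpleGraph.mem_neighborSet _ _ _).2 hc.1)
  show _ + 1 = Set.ncard {c | G.Adj v c ∧ ∃ κ : unitaryGroupOfForm σ ((StdForm.antidiagonal 3).over K), κ ∈ unitaryInt σ ((StdForm.antidiagonal 3).over K) ∧
        c = latticeGraphIso σ ϖ ((StdForm.antidiagonal 3).over K) (u * κ) ⟨latt (Matrix.diagonal ![(1 : K), 1, ϖ]), 2, isVertexLattice_two_N₁_of_neg hσϖ hϖ⟩ ∧ RD κ}
  rw [hset, Set.ncard_insert_of_notMem hnotmem hfinC]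

/-- **AT THE ROOT every child is outward**: `#{w ∈ GC r₀ | w ∈ R} = q · #{children κ·N₁ of r₀ with RegDir_1 κ}` (§11 with `u = 1`; a neighbour of `r₀` has distance `1`).
[cite: Serre1980Trees, I.2.3] [cite: Kottwitz1986, §3] -/
theorem ncard_regionGrandchildren_root_eq_mul_ncard_regDir (hσ : ∀ x, σ (σ x) = x) (hvσ : ∀ a, Valued.v (σ a) = Valued.v a) (hσϖ : σ ϖ = -ϖ)
    (hϖ : Valued.v ϖ = WithZero.exp (-1 : ℤ)) (hres : ∀ x : K, Valued.v x ≤ 1 → Valued.v (σ x - x) < 1) (h2 : Valued.v (2 : K) = 1) [Finite 𝓀[K]]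
    (hT : (latticeGraph σ ϖ ((StdForm.antidiagonal 3).over K)).IsTree)
    {γ : unitaryGroupOfForm σ ((StdForm.antidiagonal 3).over K)} (hγ0 : γ ∈ unitaryInt σ ((StdForm.antidiagonal 3).over K))
    (A : GL (Fin 3) K) (hA : IsIntMatrix (A : Matrix (Fin 3) (Fin 3) K)) (hA' : IsIntMatrix ((A⁻¹ : GL (Fin 3) K) : Matrix (Fin 3) (Fin 3) K))
    {d : Fin 3 → K} (hd : ∀ i, Valued.v (d i) = 1) (hdA : Matrix.diagonal d = (-(Matrix.diagonal d).det) • formCongr σ A ((StdForm.antidiagonal 3).over K))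
    (s : Fin 3 → K) (hγA : ((γ : GL (Fin 3) K) : Matrix (Fin 3) (Fin 3) K) = (A : Matrix (Fin 3) (Fin 3) K) * Matrix.diagonal s * ((A⁻¹ : GL (Fin 3) K) : Matrix (Fin 3) (Fin 3) K))
    (i₀ : Fin 3) {d₀ : ℕ} (hd2 : 2 ≤ d₀) (he : ∀ i, Valued.v (s i - 1) ≤ Valued.v ϖ ^ d₀) (hiso : ∀ m, m ≠ i₀ → Valued.v (s i₀ - s m) = Valued.v ϖ ^ d₀) {s' : ℕ}
    (hgap : ∀ j k, j ≠ i₀ → k ≠ i₀ → j ≠ k → Valued.v (s j - s k) = Valued.v ϖ ^ (d₀ + 2 * s')) {k : Fin 3} (hk : k ≠ i₀) :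
    {w | w ∈ {w | ∃ c, ((latticeGraph σ ϖ ((StdForm.antidiagonal 3).over K)).Adj ⟨stdLattice K 3, 0, isSelfDualLattice_stdLattice_three_of_v hϖ⟩ c ∧ (latticeGraph σ ϖ ((StdForm.antidiagonal 3).over K)).dist ⟨stdLattice K 3, 0, isSelfDualLattice_stdLattice_three_of_v hϖ⟩ c = (latticeGraph σ ϖ ((StdForm.antidiagonal 3).over K)).dist ⟨stdLattice K 3, 0, isSelfDualLattice_stdLattice_three_of_v hϖ⟩ (⟨stdLattice K 3, 0, isSelfDualLattice_stdLattice_three_of_v hϖ⟩ : {M : Submodule 𝒪[K] (Fin 3 → K) // IsVertex σ ϖ ((StdForm.antidiagonal 3).over K) M}) + 1 ∧ latticeGraphIso σ ϖ ((StdForm.antidiagonal 3).over K) γ c = c) ∧ ((latticeGraph σ ϖ ((StdForm.antidiagonal 3).over K)).Adj c w ∧ (latticeGraph σ ϖ ((StdForm.antidiagonal 3).over K)).dist ⟨stdLattice K 3, 0, isSelfDualLattice_stdLattice_three_of_v hϖ⟩ w = (latticeGraph σ ϖ ((StdForm.antidiagonal 3).over K)).dist ⟨stdLattice K 3, 0,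 isSelfDualLattice_stdLattice_three_of_v hϖ⟩ c + 1 ∧ latticeGraphIso σ ϖ ((StdForm.antidiagonal 3).over K) γ w = w)} ∧
        (latticeGraphIso σ ϖ ((StdForm.antidiagonal 3).over K) γ w = w ∧ IsSelfDualLattice σ ϖ ((StdForm.antidiagonal 3).over K) w.1 ∧
          w.1.map ((Matrix.toLin' (((γ : GL (Fin 3) K) : Matrix (Fin 3) (Fin 3) K) - 1)).restrictScalars 𝒪[K]) ≤ scaleLattice (ϖ ^ d₀) w.1)}.ncard =
      Nat.card 𝓀[K] * {c : {M : Submodule 𝒪[K] (Fin 3 → K) // IsVertex σ ϖ ((StdForm.antidiagonal 3).over K) M} | (latticeGraph σ ϖ ((StdForm.antidiagonal 3).over K)).Adj ⟨stdLattice K 3, 0, isSelfDualLattice_stdLattice_three_of_v hϖ⟩ c ∧ ∃ κ : unitaryGroupOfForm σ ((StdForm.antidiagonal 3).over K), κ ∈ unitaryInt σ ((StdForm.antidiagonal 3).over K) ∧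
        c = latticeGraphIso σ ϖ ((StdForm.antidiagonal 3).over K) (1 * κ) ⟨latt (Matrix.diagonal ![(1 : K), 1, ϖ]), 2, isVertexLattice_two_N₁_of_neg hσϖ hϖ⟩ ∧
        (Valued.v (pairing σ ((StdForm.antidiagonal 3).over K) ((((1 * κ : unitaryGroupOfForm σ ((StdForm.antidiagonal 3).over K)) : GL (Fin 3) K) : Matrix (Fin 3) (Fin 3) K) *ᵥ Pi.single 0 1)
            ((A : Matrix (Fin 3) (Fin 3) K) *ᵥ Pi.single i₀ 1)) < 1 ∧
          Valued.v (pairing σ ((StdForm.antidiagonal 3).over K) ((((1 * κ : unitaryGroupOfForm σ ((StdForm.antidiagonal 3).over K)) : GL (Fin 3) K) : Matrix (Fin 3) (Fin 3) K) *ᵥ Pi.single 0 1)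
            (ϖ ^ s' • ((A : Matrix (Fin 3) (Fin 3) K) *ᵥ Pi.single k 1))) < 1)}.ncard := by
  set r : {M : Submodule 𝒪[K] (Fin 3 → K) // IsVertex σ ϖ ((StdForm.antidiagonal 3).over K) M} :=
    ⟨stdLattice K 3, 0, isSelfDualLattice_stdLattice_three_of_v hϖ⟩ with hr
  have hϖ0 : ϖ ≠ 0 := fun h0 => by rw [h0, map_zero] at hϖ; exact WithZero.coe_ne_zero hϖ.symm
  have hru : r = latticeGraphIso σ ϖ ((StdForm.antidiagonal 3).over K) 1 r :=
    Subtype.ext (by rw [latticeGraphIso_apply_coe]; change stdLattice K 3 = mapGL ((1 : unitaryGroupOfForm σ ((StdForm.antidiagonal 3).over K)) : GL (Fin 3) K) (stdLattice K 3); rw [Subgroup.coe_one, mapGL_one])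
  have hfix : latticeGraphIso σ ϖ ((StdForm.antidiagonal 3).over K) γ r = r :=
    Subtype.ext (by rw [latticeGraphIso_apply_coe]; exact mapGL_stdLattice_of_mem_unitaryInt hγ0)
  have hvR : r.1.map ((Matrix.toLin' (((γ : GL (Fin 3) K) : Matrix (Fin 3) (Fin 3) K) - 1)).restrictScalars 𝒪[K]) ≤ scaleLattice (ϖ ^ d₀) r.1 :=
    map_sub_one_stdLattice_le_scaleLattice_of_eigenframe A hA hA' s hγA (pow_ne_zero _ hϖ0) (fun i => by rw [map_pow]; exact he i)
  rw [ncard_regionGrandchildren_eq_mul_ncard_regDir hσ hvσ hσϖ hϖ hres h2 hT A hd hdA s hγA i₀ hd2 he hiso hgap hk 1 hru hfix hvR]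
  congr 2
  ext c
  simp only [Set.mem_setOf_eq, and_congr_right_iff]
  intro hadj
  have hd1 : (latticeGraph σ ϖ ((StdForm.antidiagonal 3).over K)).dist r c = (latticeGraph σ ϖ ((StdForm.antidiagonal 3).over K)).dist r r + 1 := by
    rw [SimpleGraph.dist_self, zero_add]; exact SimpleGraph.dist_eq_one_iff_adj.2 hadj
  exact ⟨fun h => h.2, fun h => ⟨hd1, h⟩⟩

end Literature.NumberTheory.Automorphic.UnitaryLatticeTree

end
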